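import Summits.AtomisticToContinuum.BoseEinsteinCondensation.Theorems.BECConjugateDominationInfraredMinimumUncertaintyTiltReflection
import Summits.AtomisticToContinuum.BoseEinsteinCondensation.Theorems.BECConjugateDominationInfraredMinimumUncertaintyStubTiltedGeneratorIdentity

/-!
# Line `tilted-coherence-work-variance` — crux `BECConjugateDomination.InfraredMinimumUncertainty`
(stmt-AtomisticToContinuum-11784) · skeleton, crux-plan **gen 1** (round 2)
(planner-cruxplan-stmt-AtomisticToContinuum-11784-tilted-coherence-wor-0, 2026-08-16)

Idea card `Cruxes/InfraredMinimumUncertainty/Ideas/tilted-coherence-work-variance.md` (crux-ideate r2,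
ideator 4; triage r2-1 PASS, r2-2 PASS).  Line card: `Lines/tilted-coherence-work-variance.md`.

**The crux** (fixed; `Theses.BECConjugateDomination.InfraredMinimumUncertainty`, here reached through the
tree's named restatement `InfraredMinimumUncertaintyNamed ↔ InfraredMinimumUncertainty`, `Iff.rfl`,
`Theorems/BECConjugateDominationDefs.lean`): for every smooth-class `v`, `∃ C ≥ 0, ρ₀ > 0` such that for
`0 < ρ < ρ₀`, eventually in `N = n+1`, every positive minimiser `Ψ` on the torus of side
`L = (N/ρ)^{1/3}` and every mode `m ≠ 0`:  `Π_m := N · ν_m · S_m ≤ C`  (`ν_m = Re ĉ_m(log g)` the Lévy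
weight of the translation-averaged coherence `g`, `S_m` the static structure factor).

**The lever.** `ν_m` is the ONE object of the crux that is not quadratic/spectral (a Fourier
coefficient of a LOGARITHM).  Thermodynamic integration along the geometric interpolation
`Φ_t = Ψ^{1-t} (Ψ∘τ_r)^t` between the positive minimiser and its one-particle translate
(`τ_r X = (x₀ + r, x₁, …, x_n)`) removes the logarithm EXACTLY: with the displacement WORK
`δU_r = log Ψ − log Ψ∘τ_r` and the tilted probability measures `μ_t ∝ Φ_t² dX`,
`ψ_r(t) := log ∫ Ψ^{2(1-t)}(Ψ∘τ_r)^{2t}` is convex, `ψ_r(0) = ψ_r(1) = 0` (normalisation, and shift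
invariance of the cell measure), `ψ_r(½) = log g(r)`, `ψ_r'' = 4 Var_{μ_t}(δU_r)`, whence the identity
  (TI)   `log g(r) = −2 ∫₀¹ min(t,1−t) · Var_{μ_t}(δU_r) dt`,  so  `ν_m = −2 ∫₀¹ min(t,1−t) V̂_t(m) dt`,
`V̂_t(m) := Re ĉ_m[r ↦ Var_{μ_t^{(r)}}(δU_r)]`, and with `Π_t(m) := −N S_m V̂_t(m)/2`:
`Π_m = ∫₀¹ 4 min(t,1−t) Π_t(m) dt` (the crux is the `4min(t,1−t)dt`-AVERAGE of the tilted products).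
(TI) is KINEMATIC (every positive state).  MINIMALITY enters pointwise and twice: `Ψ` AND `Ψ∘τ_r`
solve the Schrödinger equation (potentials `W`, `W∘τ_r`, same `E₀`), so every `Φ_t` is an exact
ground state of `H_t = −Δ + (1−t)W + tW∘τ_r − t(1−t)|∇δU_r|²`, and the generator
`L_t = Δ − 2∇U_t·∇` of `μ_t` acts on the work by  `−L_t δU_r = (W∘τ_r − W) − (1−2t)|∇δU_r|²`;
at the BRIDGE `t = ½` the work is the corrector of a linear Poisson problem with the local,
divergence-form source `W∘τ_r − W`, and `Var_{μ_½}(δU_r) = ⟨s, (−L_½)⁻² s⟩ = m₋₂(s)` is an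
inverse-SQUARE spectral moment of that source in the bridge ground state.

**The cut — lead reshape r2 (2026-08-16, seat a2-0): 3 registered stubs S1, S2, S34; composition
`InfraredMinimumUncertainty_of`, sorry-free.  The planner's S3 `stub_tiltStability` (relative tilt
stability) and S4 `stub_bridgeVarianceCeiling` (bridge slice) are MERGED into S34 (all tilts on `[0,½]`):
the S3 worker (wave 1) proved the tilt reflection `Π_{1−t} = Π_t` (landed toolkit `…TiltReflection.lean`)
and returned S3 blocked on a `1/(N S_m)`-precision flatness estimate of the same strength class as S4
(even work-cumulant profiles of the bridge law), so the relative statement buys nothing over the absolute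
one.  Planner's description of the original four stubs kept below for the record.**

**The cut (planner, gen 1: 4 registered stubs; composition `InfraredMinimumUncertainty_of`, sorry-free):**
* `stub_tiltedLevyIdentity`      (S1, M, kinematic, provable now) — (TI) pointwise in `r`, its
  Fourier-profile form `ν_m = −2∫₀¹ min(t,1−t) V̂_t(m) dt`, and continuity of `t ↦ V̂_t(m)` on `[0,1]`
  (the Fubini / dominated-differentiation content is INSIDE this stub, triage r2-2 (3)).
* `stub_tiltedGeneratorIdentity` (S2, M, minimality-carrying, provable now from tree material) — the
  weak generator identity `∫ ∇η·∇δU_r dμ_t = ∫ η[(W∘τ_r − W) − (1−2t)|∇δU_r|²] dμ_t` for all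
  `t ∈ [0,1]`, all `r`, all `C¹` periodic `η` (its `t = ½` instance is the BRIDGE POISSON IDENTITY;
  `t = 0`, `η ≡ 1` is the displacement-energy identity `E_Ψ²|∇δU_r|² = E_Ψ²[W∘τ_r − W] ≥ 0`).
  Route to a proof: uniqueness of the positive minimiser (`stub_positiveMinimiserUnique`,
  Theorems/…PuffFloorPositiveMinimiserUnique) + `C³` regularity (`PositiveMinimiser_proof`) + the
  pointwise eigen-equation (`PuffFloorEulerLagrange.eulerLagrange_pointwise`) for `Ψ` and, by
  translation covariance, for `Ψ∘τ_r`; then one periodic integration by parts.  (NOT the symmetric-test-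
  function weak E–L p78669 alone: `η·Ψ∘τ_r` is not Bose-symmetric.)
* `stub_tiltStability`           (S3, L) — TILT STABILITY: `Π_t(m) ≤ C₁·max(Π_½(m),0) + C₂` for all
  `t ∈ [0,1]` (triage r2-1: the toy's binding slice is `t = 0`, so this stub is NOT optional; it is the
  `L/N`-precision passage from the bridge family to the other tilts).  Stated for exact positive
  minimisers WITH the generator identity of S2 as a hypothesis (every `μ_t` is an explicit ground-state
  measure).  Toy: `sup_t Π_t ≤ 1.12·max_m Π_m` (kit j016956, 10 exact BH ground states, d = 1,2,3);
  Tonks–Girardeau (kit j017538, exact Fisher–Hartwig): `Var_t(r) − Var_½(r)` is `r`-INDEPENDENT at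
  leading order, `Π_t(m) → ¼` for every `t`.
* `stub_bridgeVarianceCeiling`   (S4, XL, LOAD-BEARING, BEC-strength — conceded) — the bridge slice
  `Π_½(m) ≤ C`, i.e. `−N S_m · Re ĉ_m[r ↦ Var_{μ_½^{(r)}}(δU_r)] ≤ 2C`: an `m₋₂` CEILING for the local
  source `W∘τ_r − W` in the `r`-indexed bridge family (measure, generator and source all depend on
  `r` — typed as such, triage r2-1), with S2's identity as hypothesis.  Physically: a phonon-scale
  harmonic-mean floor for the relative density mode `B_k` in `μ_½`, strictly between the sibling
  statements stmt-12057 (`m₋₁`, static response) and stmt-9091 (true sector gap) (triage r2-2 A3).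
Composition: S3 ∧ S4 ⇒ `Π_t(m) ≤ C₁C₄ + C₂` on `[0,1]`; S1 ⇒ `Π_m = ∫₀¹ 4min(t,1−t)Π_t(m)dt ≤
2(C₁C₄ + C₂)` (`0 ≤ 4min(t,1−t) ≤ 2`); S2 discharges the generator-identity hypothesis of S3/S4.

**Disproof.lean (gen 2) honoured.** `imu_false_without_minimality` /
`not_infraredMinimumUncertaintyNearMinimisers` (Negative/MinimalityLoadBearing): S1 is kinematic and
holds on the §W free density wave too, so ALL minimality sits in S2's pointwise eigen-equations for
`Ψ` and `Ψ∘τ_r` — false for `δ`-near-minimisers at every `N`-uniform slack (there is no `H_t`) — and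
S3/S4 quantify over EXACT minimisers and carry S2's conclusion as hypothesis ("the line uses
minimality at S2, consumed by S3 and S4").  `pi_eq_zero_of_free_minimiser` / `body_zero` (`v ≡ 0`):
free minimisers are constants, `δU_r ≡ 0`, `Π_t ≡ 0` — `tiltedProduct_eq_zero_of_free_minimiser`
below (consistent with `C = 0`).  `imu_iff_allModes`: `m = 0` harmless (`V̂_t(0) ≥ 0`).  The
circularity certificates of the dead line (`…LineCircularity` p96009, `phaseSteinDomination_of_imu`
p82312) do not apply: S3/S4 quantify over the tilt family `{μ_t}` (states other than `Ψ²`), and no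
state-internal identity (linear test field / f-sum / Cramér–Rao) expresses `V̂_t` through `(ν_m, S_m)`;
IMU is a strict `t`-average of the transfer.  `structureFactorCeiling_false`,
`levyWeight_nonpos_at_bornZero`: no `S`-ceiling, nothing first-order/Born is used.

Objects (lead reshape r1, 2026-08-16, seat a2-0): declared in the landed line vocabulary
`Theorems/BECConjugateDominationTiltedCoherenceDefs.lean` (bodies verbatim the planner's), imported here,
so that the registered stub signatures below and the stub workers' Theorems files denote the SAME
constants: `shiftFirst`, `work`, `tiltWeight`, `tiltNorm`, `tiltMean`, `tiltVar`, `tiltVarCoeff`,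
`tiltedProduct`, `TiltedGeneratorIdentityAt`, `TiltedMinimumUncertainty`.
-/

noncomputable section

open MeasureTheory Filter Set
open scoped ENNReal NNReal Topology BigOperators

namespace Summit.AtomisticToContinuum.BoseEinsteinCondensation.Cruxes.InfraredMinimumUncertainty.TiltedCoherenceWorkVariance

open Literature.MathematicalPhysics.QuantumManyBody.BoseGas
open Summit.AtomisticToContinuum.BoseEinsteinCondensation.Theses.BECConjugateDomination
  (InfraredMinimumUncertainty)
open Summit.AtomisticToContinuum.BoseEinsteinCondensation.Cruxes.InfraredMinimumUncertainty.FisherGaussianDensityMode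
  (InSmoothClass IsPositiveMinimiser coherence levyWeight structureFactor CruxFrame
    InfraredMinimumUncertaintyNamed infraredMinimumUncertainty_iff_named mul_structureFactor_nonneg)
open Summit.AtomisticToContinuum.BoseEinsteinCondensation.Theorems.BECConjugateDomination
  (tiltedProduct_one_sub stub_tiltedLevyIdentity stub_tiltedGeneratorIdentity)

variable {n : ℕ} {L : ℝ}

/-! ## Objects: `Theorems/BECConjugateDominationTiltedCoherenceDefs.lean` (landed by the lead, p117718;
tilt reflection toolkit `Theorems/…TiltReflection.lean`):
`shiftFirst`, `work`, `tiltWeight`, `tiltNorm`, `tiltMean`, `tiltVar`, `tiltVarCoeff`, `tiltedProduct`,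
`TiltedGeneratorIdentityAt`, `TiltedMinimumUncertainty`, positive control `tiltedProduct_free_control`. -/

/-! ## Registered stubs -/

/-! ### S1 `stub_tiltedLevyIdentity` and S2 `stub_tiltedGeneratorIdentity`: LANDED (wave 1)
`Theorems/BECConjugateDominationInfraredMinimumUncertaintyStubTiltedLevyIdentity.lean` (p119407) and
`Theorems/BECConjugateDominationInfraredMinimumUncertaintyStubTiltedGeneratorIdentity.lean` (p119409), namespace
`…Theorems.BECConjugateDomination`, registered signatures verbatim; imported and used below by name. -/

/-- **S34 `stub_tiltedUncertaintyHalfTilts` — the transfer `C⁺` on the half range `t ∈ [0,½]`, given the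
generator identity (HARDEST, load-bearing, XL; BEC-strength — conceded; lead reshape r2 merges the
planner's S3 `stub_tiltStability` and S4 `stub_bridgeVarianceCeiling`; the other half `t ∈ [½,1]` is the
landed tilt reflection `Π_{1−t} = Π_t`, `Theorems/…TiltReflection.lean`).**
For smooth-class `v` there are `C ≥ 0`, `ρ₀ > 0` such that for `0 < ρ < ρ₀`, eventually in `N = n+1`, for
every positive minimiser `Ψ` on the torus of side `(N/ρ)^{1/3}` satisfying the tilted generator identity
(S2's conclusion: every `μ_t` is an explicit ground-state measure, `−L_t δU_r = (W∘τ_r − W) − (1−2t)|∇δU_r|²`),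
every `m ≠ 0` and every tilt `t ∈ [0,½]` (bridge slice `t = ½` included):
`Π_t(m) = −N · S_m · Re ĉ_m[r ↦ Var_{μ_t^{(r)}}(δU_r)] / 2 ≤ C`.
Why one stub and not two: in cumulant coordinates (`ψ_r(t) = K_r(−2t)`, the CGF of the work under `Ψ²`;
`Λ_m(t) = Re ĉ_m[ψ_·(t)]`, `Λ_m'' = 4V̂_t(m)`) the bridge slice is the second-cumulant profile of the
(symmetric, by inversion symmetry) bridge work law and every other slice differs from it by the EVEN higher
cumulant profiles `ĉ_m[κ_{2j,½}]`, which power counting puts at the same order `1/(N S_m)` as the variance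
profile itself: the relative statement S3 is no easier than the absolute one, both are the `1/k` law.
Why plausibly true: Bogoliubov/Gaussian-work order `Π_t(m) ≡ Π_m = (1−S_m)²/4 ≤ ¼` for every `t`; toys (kit
j016956: `sup_{t,m}Π_t ≤ 1.12·max_m Π_m`; TG exact kit j017538: `Π_t(m) → ¼ ∀t`, `Π_t ↓` on `[0,½]`). -/
theorem stub_tiltedUncertaintyHalfTilts :
    ∀ v : ℝ → ℝ≥0∞, InSmoothClass v → ∃ C : ℝ, 0 ≤ C ∧ ∃ ρ₀ : ℝ, 0 < ρ₀ ∧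
      ∀ ρ : ℝ, 0 < ρ → ρ < ρ₀ → ∀ᶠ n : ℕ in atTop,
        ∀ Ψ : PeriodicTrialState (n + 1) (sideLength ρ (n + 1)),
          IsPositiveMinimiser v Ψ → TiltedGeneratorIdentityAt v Ψ →
            ∀ m : Fin 3 → ℤ, m ≠ 0 → ∀ t ∈ Set.Icc (0 : ℝ) (1 / 2),
              tiltedProduct n (sideLength ρ (n + 1)) Ψ t m ≤ C := by
  sorry

/-! ## The TRANSFER `C⁺` of the card, and the two kernel-checked glue steps -/

/-! `TiltedMinimumUncertainty` (the transfer `C⁺`) is declared in the Defs file. -/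

/-- **Glue 1 (sorry-free): S2 ∧ S34 ∧ tilt reflection ⇒ `C⁺`** (all `t ∈ [0,1]`): S2 supplies the
generator identity that S34 takes as hypothesis; a tilt `t > ½` is sent to `1 − t < ½` by the landed
`tiltedProduct_one_sub` (`Π_{1−t} = Π_t`, translation covariance + reality). -/
theorem tiltedMinimumUncertainty_of_stubs : TiltedMinimumUncertainty := by
  intro v hv
  obtain ⟨C, hC, ρ₀, hρ₀, h⟩ := stub_tiltedUncertaintyHalfTilts v hv
  refine ⟨C, hC, ρ₀, hρ₀, fun ρ hρ hρρ₀ => ?_⟩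
  filter_upwards [h ρ hρ hρρ₀] with n hn
  intro Ψ hmin m hm t ht
  have hL : 0 < sideLength ρ (n + 1) := by
    unfold sideLength
    exact Real.rpow_pos_of_pos (by positivity) _
  have hgen : TiltedGeneratorIdentityAt v Ψ :=
    stub_tiltedGeneratorIdentity v hv n (sideLength ρ (n + 1)) hL Ψ hmin
  rcases le_or_gt t (1 / 2) with hle | hgt
  · exact hn Ψ hmin hgen m hm t ⟨ht.1, hle⟩
  · have hs : 1 - t ∈ Set.Icc (0 : ℝ) (1 / 2) := ⟨by linarith [ht.2], by linarith⟩
    have hrefl : tiltedProduct n (sideLength ρ (n + 1)) Ψ t m =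
        tiltedProduct n (sideLength ρ (n + 1)) Ψ (1 - t) m := by
      have := tiltedProduct_one_sub Ψ hL (1 - t) m
      rw [sub_sub_cancel] at this
      exact this
    rw [hrefl]
    exact hn Ψ hmin hgen m hm (1 - t) hs

/-- **Glue 2 (sorry-free): `C⁺ ∧ S1 ⇒` the crux over the named objects** (the card's
`TransferComposition`, kernel-checked): S1 (b) turns `N·ν_m·S_m` into
`∫₀¹ 4min(t,1−t)·Π_t(m) dt` (`N S_m ≥ 0` pulled inside), S1 (c) makes the integrand integrable, and
`0 ≤ 4min(t,1−t) ≤ 2` on `[0,1]` with `Π_t ≤ C` gives `N·ν_m·S_m ≤ 2C`. -/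
theorem infraredMinimumUncertaintyNamed_of_tilted (hT : TiltedMinimumUncertainty) :
    InfraredMinimumUncertaintyNamed := by
  intro v hv₁ hv₂ hv₃ hv₄
  have hv : InSmoothClass v := ⟨hv₁, hv₂, hv₃, hv₄⟩
  obtain ⟨K, hK, ρ₀, hρ₀, hB⟩ := hT v hv
  refine ⟨2 * K, by positivity, ρ₀, hρ₀, fun ρ hρ hρρ₀ => ?_⟩
  filter_upwards [hB ρ hρ hρρ₀] with n hn
  intro Ψ hE hfin hreal hpos m hm
  have hL : 0 < sideLength ρ (n + 1) := by
    unfold sideLength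
    exact Real.rpow_pos_of_pos (by positivity) _
  have hbound : ∀ t ∈ Set.Icc (0 : ℝ) 1, tiltedProduct n (sideLength ρ (n + 1)) Ψ t m ≤ K :=
    hn Ψ ⟨hE, hfin, hreal, hpos⟩ m hm
  -- S1: the crux's Lévy weight as a tilt average, with continuity of the profile coefficient
  obtain ⟨hlevy, hcont⟩ := (stub_tiltedLevyIdentity n (sideLength ρ (n + 1)) hL Ψ hpos).2 m
  -- integrability of the tilt integrand on `[0,1]` (continuity, S1 (c))
  have hI : IntervalIntegrable
      (fun t : ℝ => min t (1 - t) * tiltVarCoeff n (sideLength ρ (n + 1)) Ψ t m) volume 0 1 := by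
    apply ContinuousOn.intervalIntegrable
    rw [Set.uIcc_of_le zero_le_one]
    have hc : Continuous fun t : ℝ => min t (1 - t) :=
      continuous_id.min (continuous_const.sub continuous_id)
    exact hc.continuousOn.mul hcont
  -- the crux's product IS the weighted tilt average (S1 (b))
  have key : ((n : ℝ) + 1) * levyWeight n (sideLength ρ (n + 1)) Ψ m *
        structureFactor n (sideLength ρ (n + 1)) Ψ m =
      ∫ t in (0 : ℝ)..1,
        (-2 * (((n : ℝ) + 1) * structureFactor n (sideLength ρ (n + 1)) Ψ m)) *
          (min t (1 - t) * tiltVarCoeff n (sideLength ρ (n + 1)) Ψ t m) := by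
    rw [intervalIntegral.integral_const_mul, hlevy]
    ring
  rw [key]
  calc ∫ t in (0 : ℝ)..1,
        (-2 * (((n : ℝ) + 1) * structureFactor n (sideLength ρ (n + 1)) Ψ m)) *
          (min t (1 - t) * tiltVarCoeff n (sideLength ρ (n + 1)) Ψ t m)
      ≤ ∫ t in (0 : ℝ)..1, 2 * K := by
        refine intervalIntegral.integral_mono_on zero_le_one (hI.const_mul _)
          intervalIntegrable_const fun t ht => ?_
        have hm0 : 0 ≤ min t (1 - t) := le_min ht.1 (by linarith [ht.2])
        have hm1 : min t (1 - t) ≤ 1 / 2 := by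
          rcases le_total t (1 / 2) with h | h
          · exact (min_le_left _ _).trans h
          · exact (min_le_right _ _).trans (by linarith)
        have hP : tiltedProduct n (sideLength ρ (n + 1)) Ψ t m ≤ K := hbound t ht
        have hrw : (-2 * (((n : ℝ) + 1) * structureFactor n (sideLength ρ (n + 1)) Ψ m)) *
              (min t (1 - t) * tiltVarCoeff n (sideLength ρ (n + 1)) Ψ t m) =
            4 * min t (1 - t) * tiltedProduct n (sideLength ρ (n + 1)) Ψ t m := by
          unfold tiltedProduct
          ring
        rw [hrw]
        nlinarith [mul_nonneg hm0 (sub_nonneg.2 hP), mul_nonneg (sub_nonneg.2 hm1) hK]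
    _ = 2 * K := by simp

/-! ## The skeleton concludes the crux BY NAME -/

/-- **`InfraredMinimumUncertainty`** (route `BECConjugateDomination`, stmt-AtomisticToContinuum-11784) from
the four registered stubs — the ONLY theorem of this file concluding the route decl by name:
S2 ∧ S34 ∧ reflection ⇒ `C⁺` (`tiltedMinimumUncertainty_of_stubs`), `C⁺ ∧ S1 ⇒` the named crux
(`infraredMinimumUncertaintyNamed_of_tilted`), and `infraredMinimumUncertainty_iff_named` (`Iff.rfl` in
the tree) is the certificate that `levyWeight`/`structureFactor`/`sideLength` ARE the crux's `let`s.
Constants: `C_IMU = 2C`, `ρ₀` of S34. -/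
theorem InfraredMinimumUncertainty_of : InfraredMinimumUncertainty :=
  infraredMinimumUncertainty_iff_named.mp
    (infraredMinimumUncertaintyNamed_of_tilted tiltedMinimumUncertainty_of_stubs)

end Summit.AtomisticToContinuum.BoseEinsteinCondensation.Cruxes.InfraredMinimumUncertainty.TiltedCoherenceWorkVariance

end
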